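import Literature.MathematicalPhysics.QuantumLattice.LiebWuNeumannSeries
import HarnessLib

/-!
# The Neumann series of Lieb–Wu's Theorem 1 for a general rapidity range (`0 < B ≤ ∞`)

Family `hubbard`. Lieb–Wu, PRL 20 (1968) 1445, statement (a): "Equations (13)–(16) have a unique
solution which is positive **for all allowed `B` and `Q`**"; Physica A 321 (2003) 1, §5, THEOREM 1
(for each `0 < Q ≤ π`, `0 < B ≤ ∞`). `LiebWuNeumannSeries` carried out the printed iteration
`σ = (1 + Ŵ + Ŵ² + …)ξ` (eq. (series)) at `B = ∞`, where `Ŵ = R̂ÂK̂`. For a general rapidity range the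
printed operator is (eq. (W)) `Ŵ = R̂K̂(1 - B̂) + R̂ÂK̂B̂`, `B̂` = multiplication by the indicator of the
range; this file carries out the same iteration for an arbitrary measurable rapidity set `S ⊆ ℝ` (the
printed case is `S = [-B, B]`; `S = ℝ` recovers `LiebWuNeumannSeries` definitionally, `liebWuWS_univ`):

* `liebWuWS U Q S h = Ŵ(1_S h)|_{B=∞-operator} + u ∗ (1_{Sᶜ} h)` — the kernel form of
  `R̂ÂK̂B̂ + R̂K̂(1 - B̂)` (`R̂K̂ = Û` has kernel `u = fermiKernel (U/4)`, `R̂` has kernel `r/2`);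
* `liebWuNeumannTermS U Q S n = Ŵⁿξ`, `liebWuSigmaAtS U Q S = Σₙ Ŵⁿξ` (`ξ = liebWuXi U Q` does not depend
  on the range).

PROVED (`U > 0`, `0 < Q`, `S` measurable): `Ŵ` preserves continuous nonnegative integrable functions
with `∫ Ŵh ≤ ½∫h` (Lieb–Wu: "`‖Ŵ‖ < 1`"; here column sums `∫u = ½`, `½∫r · ∫_{(-a,a]}K ≤ ½`) and
`sup Ŵh ≤ (1/U)∫h`; hence every term is continuous, nonnegative, integrable, `∫Ŵⁿξ ≤ 2⁻ⁿ∫ξ`, the series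
converges uniformly, and `σ_S = liebWuSigmaAtS U Q S` is continuous, positive (`≥ ξ`), integrable with
`∫σ_S ≤ 2∫ξ`; `Ŵ` is monotone (`liebWuWS_mono`). The fixed-point equation **`σ_S = ξ + Ŵσ_S`** is
`LiebWuFiniteBFixedPoint`; translating it into (13)–(14) on the range `S = [-B, B]` is done in the
companion existence file. No named fact.

## References

* E. H. Lieb, F. Y. Wu, Physica A 321 (2003) 1–27 = arXiv:cond-mat/0207529, §5, Theorem 1, eqs. (S),
  (R), (W), (series) (key `LiebWuPhysicaA2003`); PRL 20 (1968) 1445, statement (a) (`LiebWuPRL1968`).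
-/

noncomputable section

open MeasureTheory Set Real Filter intervalIntegral
open Literature.Analysis.SpecialFunctions
open scoped Convolution Topology

namespace Literature.MathematicalPhysics.QuantumLattice

namespace LiebWuNeumannS

variable {f g : ℝ → ℝ} {B : ℝ}

/-- `t ↦ f(t) g(x - t)` is integrable for `f ∈ L¹`, `g` bounded continuous. [folklore] -/
private theorem integrable_mul_sub (hf : Integrable f) (hgc : Continuous g) (hgB : ∀ y, |g y| ≤ B)
    (x : ℝ) : Integrable fun t => f t * g (x - t) :=
  hf.mul_bdd (hgc.comp (continuous_const.sub continuous_id)).aestronglyMeasurable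
    (Eventually.of_forall fun t => by rw [Real.norm_eq_abs]; exact hgB _)

/-- `x ↦ ∫ f(t) g(x - t) dt` is Mathlib's convolution for the multiplication pairing. [folklore] -/
private theorem conv_eq_convolution (f g : ℝ → ℝ) :
    (fun x => ∫ t, f t * g (x - t)) = f ⋆[ContinuousLinearMap.mul ℝ ℝ, volume] g := by
  funext x
  rw [convolution_def]
  simp only [ContinuousLinearMap.mul_apply']

/-- `x ↦ ∫ f(t) g(x - t) dt` is continuous for `f ∈ L¹`, `g` bounded continuous. [folklore] -/
private theorem continuous_conv (hf : Integrable f) (hgc : Continuous g) (hgB : ∀ y, |g y| ≤ B) :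
    Continuous fun x => ∫ t, f t * g (x - t) := by
  rw [conv_eq_convolution]
  refine BddAbove.continuous_convolution_right_of_integrable (L := ContinuousLinearMap.mul ℝ ℝ)
    ⟨B, ?_⟩ hf hgc
  rintro _ ⟨y, rfl⟩
  exact (Real.norm_eq_abs _).trans_le (hgB y)

/-- `∫∫ f(t) g(x - t) dt dx = (∫ f)(∫ g)` for `f, g ∈ L¹`, and the convolution is integrable. [folklore] -/
private theorem integrable_conv_and_integral (hf : Integrable f) (hg : Integrable g) :
    Integrable (fun x => ∫ t, f t * g (x - t)) ∧
      ∫ x, ∫ t, f t * g (x - t) = (∫ t, f t) * ∫ y, g y := by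
  rw [conv_eq_convolution]
  exact ⟨hf.integrable_convolution _ hg, by
    rw [integral_convolution (L := ContinuousLinearMap.mul ℝ ℝ) hf hg]; rfl⟩

/-- `0 ≤ ∫ f(t) g(x - t) dt ≤ B ∫ f` for `f, g ≥ 0`, `g ≤ B`, `f ∈ L¹`. [folklore] -/
private theorem conv_nonneg_le (hf : Integrable f) (hf0 : ∀ t, 0 ≤ f t) (hg0 : ∀ y, 0 ≤ g y)
    (hgB : ∀ y, g y ≤ B) (x : ℝ) :
    0 ≤ ∫ t, f t * g (x - t) ∧ ∫ t, f t * g (x - t) ≤ B * ∫ t, f t := by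
  refine ⟨integral_nonneg fun t => mul_nonneg (hf0 t) (hg0 _), ?_⟩
  rw [← MeasureTheory.integral_const_mul]
  refine integral_mono_of_nonneg (Eventually.of_forall fun t => mul_nonneg (hf0 t) (hg0 _))
    (hf.const_mul B) (Eventually.of_forall fun t => ?_)
  dsimp only
  rw [mul_comm B]
  exact mul_le_mul_of_nonneg_left (hgB _) (hf0 t)

/-- Indicator restriction of a nonnegative integrable function: integrable, between `0` and the function.
[folklore] -/
private theorem indicator_props {S : Set ℝ} (hS : MeasurableSet S) (hf : Integrable f)
    (hf0 : ∀ t, 0 ≤ f t) :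
    Integrable (S.indicator f) ∧ (∀ t, 0 ≤ S.indicator f t) ∧ ∀ t, S.indicator f t ≤ f t :=
  ⟨hf.indicator hS, fun _ => indicator_nonneg (fun t _ => hf0 t) _,
    fun _ => indicator_le_self' (fun t _ => hf0 t) _⟩

end LiebWuNeumannS

open LiebWuNeumannS

/-- The operator **`Ŵ = R̂ÂK̂B̂ + R̂K̂(1 - B̂)`** of Lieb–Wu's eq. (W) for the rapidity range `S`
(`B̂` = multiplication by `1_S`; printed case `S = [-B, B]`), in kernel form:
`(Ŵh)(x) = ½ ∫ 1_{(-a,a]}(y) (∫ 1_S(t)h(t) K_{U/4}(y - t) dt) r_{U/4}(x - y) dy + ∫ 1_{Sᶜ}(t)h(t) u_{U/4}(x - t) dt`,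
`a = sin Q`; the first summand is the `B = ∞` operator `liebWuW U Q` applied to `1_S h`, the second is
`R̂K̂ = Û` (kernel `u`) applied to `1_{Sᶜ} h`. [cite: LiebWuPhysicaA2003, §5, eq. (W)] -/
def liebWuWS (U Q : ℝ) (S : Set ℝ) (h : ℝ → ℝ) (x : ℝ) : ℝ :=
  liebWuW U Q (S.indicator h) x + ∫ t, Sᶜ.indicator h t * fermiKernel (U / 4) (x - t)

/-- The Neumann terms `Ŵⁿ ξ` for the range `S`. [cite: LiebWuPhysicaA2003, §5, eq. (series)] -/
def liebWuNeumannTermS (U Q : ℝ) (S : Set ℝ) : ℕ → ℝ → ℝ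
  | 0 => liebWuXi U Q
  | n + 1 => liebWuWS U Q S (liebWuNeumannTermS U Q S n)

/-- **`σ_S = (1 + Ŵ + Ŵ² + …) ξ`**, the Neumann-series solution of eq. (S) for the rapidity range `S`.
[cite: LiebWuPhysicaA2003, §5, eq. (series)] -/
def liebWuSigmaAtS (U Q : ℝ) (S : Set ℝ) (Λ : ℝ) : ℝ :=
  ∑' n, liebWuNeumannTermS U Q S n Λ

variable {U Q : ℝ} {S : Set ℝ} {h : ℝ → ℝ}

/-! ### `S = ℝ` is the `B = ∞` series of `LiebWuNeumannSeries` -/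

/-- At `S = ℝ` (`B̂ = 1`) the operator is the `B = ∞` operator `R̂ÂK̂`. [cite: LiebWuPhysicaA2003, §5, eq. (W)] -/
theorem liebWuWS_univ (U Q : ℝ) : liebWuWS U Q univ = liebWuW U Q := by
  funext h x
  simp [liebWuWS, indicator_univ, compl_univ]

/-- Hence the terms agree at `S = ℝ` … [cite: LiebWuPhysicaA2003, §5, eq. (series)] -/
theorem liebWuNeumannTermS_univ (U Q : ℝ) (n : ℕ) : liebWuNeumannTermS U Q univ n = liebWuNeumannTerm U Q n := by
  induction n with
  | zero => rfl
  | succ n ih => simp only [liebWuNeumannTermS, liebWuNeumannTerm, liebWuWS_univ, ih]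

/-- … and so does the solution: `σ_ℝ = liebWuSigmaAt U Q`. [cite: LiebWuPhysicaA2003, §5, eq. (series)] -/
theorem liebWuSigmaAtS_univ (U Q : ℝ) : liebWuSigmaAtS U Q univ = liebWuSigmaAt U Q := by
  funext Λ
  simp only [liebWuSigmaAtS, liebWuSigmaAt, liebWuNeumannTermS_univ]

/-! ### The operator bounds ("`‖Ŵ‖ < 1`") -/

/-- **`Ŵ` preserves the cone of continuous nonnegative integrable functions, with `∫ Ŵh ≤ ½ ∫ h` and
`sup Ŵh ≤ (1/(4c)) ∫ h`**, `c = U/4`, for every measurable range `S`: the `B̂`-part is the `B = ∞` bound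
applied to `1_S h` (`∫ ≤ ½∫1_S h`), the `(1 - B̂)`-part is convolution with `u ≥ 0`, `∫u = ½`,
`u ≤ 1/(2πc) ≤ 1/(4c)`, applied to `1_{Sᶜ} h`; the two parts see disjoint pieces of `h`.
[cite: LiebWuPhysicaA2003, §5, proof of Theorem 1] -/
theorem liebWuWS_props (hU : 0 < U) (hS : MeasurableSet S) (hhi : Integrable h) (hh0 : ∀ t, 0 ≤ h t) :
    Continuous (liebWuWS U Q S h) ∧ (∀ x, 0 ≤ liebWuWS U Q S h x) ∧ Integrable (liebWuWS U Q S h) ∧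
      (∫ x, liebWuWS U Q S h x) ≤ 1 / 2 * ∫ t, h t ∧
      ∀ x, liebWuWS U Q S h x ≤ 1 / (4 * (U / 4)) * ∫ t, h t := by
  have hc : 0 < U / 4 := by positivity
  -- the two pieces of `h`
  obtain ⟨h1i, h10, h1le⟩ := indicator_props hS hhi hh0
  obtain ⟨h2i, h20, h2le⟩ := indicator_props hS.compl hhi hh0
  have hsplit : ∀ t, S.indicator h t + Sᶜ.indicator h t = h t := fun t => by
    by_cases ht : t ∈ S
    · rw [indicator_of_mem ht, indicator_of_notMem (show t ∉ Sᶜ from fun h' => h' ht), add_zero]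
    · rw [indicator_of_notMem ht, indicator_of_mem (mem_compl ht), zero_add]
  have hint12 : (∫ t, S.indicator h t) + ∫ t, Sᶜ.indicator h t = ∫ t, h t := by
    rw [← integral_add h1i h2i]
    exact integral_congr_ae (Eventually.of_forall hsplit)
  have hI1 : 0 ≤ ∫ t, S.indicator h t := integral_nonneg h10
  have hI2 : 0 ≤ ∫ t, Sᶜ.indicator h t := integral_nonneg h20
  -- part 1: the `B = ∞` operator on `1_S h`
  obtain ⟨hW1c, hW10, hW1i, hW1int, hW1sup⟩ := liebWuW_props (Q := Q) hU h1i h10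
  -- part 2: `u ∗ (1_{Sᶜ} h)`
  have huB : ∀ y, |fermiKernel (U / 4) y| ≤ 1 / (2 * π * (U / 4)) := fun y => by
    rw [abs_of_nonneg (fermiKernel_nonneg hc y)]; exact fermiKernel_le hc y
  have hW2c : Continuous fun x => ∫ t, Sᶜ.indicator h t * fermiKernel (U / 4) (x - t) :=
    continuous_conv h2i (continuous_fermiKernel hc) huB
  obtain ⟨hW2i, hW2int⟩ := integrable_conv_and_integral h2i (integrable_fermiKernel hc)
  rw [integral_fermiKernel hc] at hW2int
  have hW2 := fun x => conv_nonneg_le h2i h20 (fermiKernel_nonneg hc) (fermiKernel_le hc) x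
  have hπ4 : 1 / (2 * π * (U / 4)) ≤ 1 / (4 * (U / 4)) :=
    one_div_le_one_div_of_le (by positivity) (by nlinarith [Real.pi_gt_three, hc])
  refine ⟨hW1c.add hW2c, fun x => add_nonneg (hW10 x) (hW2 x).1, hW1i.add hW2i, ?_, fun x => ?_⟩
  · have hunf : (fun x => liebWuWS U Q S h x) = fun x => liebWuW U Q (S.indicator h) x +
        ∫ t, Sᶜ.indicator h t * fermiKernel (U / 4) (x - t) := rfl
    rw [show (∫ x, liebWuWS U Q S h x) = ∫ x, (fun x => liebWuWS U Q S h x) x from rfl, hunf,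
      integral_add hW1i hW2i, hW2int, ← hint12]
    linarith
  · calc liebWuWS U Q S h x ≤ 1 / (4 * (U / 4)) * (∫ t, S.indicator h t) +
          1 / (2 * π * (U / 4)) * ∫ t, Sᶜ.indicator h t := add_le_add (hW1sup x) (hW2 x).2
      _ ≤ 1 / (4 * (U / 4)) * (∫ t, S.indicator h t) + 1 / (4 * (U / 4)) * ∫ t, Sᶜ.indicator h t :=
          add_le_add le_rfl (mul_le_mul_of_nonneg_right hπ4 hI2)
      _ = 1 / (4 * (U / 4)) * ∫ t, h t := by rw [← hint12]; ring

/-- **`Ŵ` is monotone** on nonnegative integrable functions (positive kernel). [cite: LiebWuPhysicaA2003, §5, eq. (W)] -/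
theorem liebWuWS_mono (hU : 0 < U) (hS : MeasurableSet S) {h₁ h₂ : ℝ → ℝ} (h₁i : Integrable h₁)
    (h₂i : Integrable h₂) (h0 : ∀ t, 0 ≤ h₁ t) (hle : ∀ t, h₁ t ≤ h₂ t) (x : ℝ) :
    liebWuWS U Q S h₁ x ≤ liebWuWS U Q S h₂ x := by
  have hc : 0 < U / 4 := by positivity
  have h20 : ∀ t, 0 ≤ h₂ t := fun t => (h0 t).trans (hle t)
  have hd : Integrable (fun t => h₂ t - h₁ t) := h₂i.sub h₁i
  have hd0 : ∀ t, 0 ≤ h₂ t - h₁ t := fun t => sub_nonneg.2 (hle t)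
  obtain ⟨_, hWd0, _⟩ := liebWuWS_props (Q := Q) hU hS hd hd0
  -- linearity of `Ŵ` in `h`: `Ŵh₂ = Ŵh₁ + Ŵ(h₂ - h₁)`
  have hKB : ∀ y, |cauchyDensity (U / 4) y| ≤ 1 / (π * (U / 4)) := fun y => by
    rw [abs_of_pos (cauchyDensity_pos hc y)]; exact cauchyDensity_le hc y
  have hrB : ∀ y, |sechKernel (U / 4) y| ≤ 1 / (2 * (U / 4)) := fun y => by
    rw [abs_of_pos (sechKernel_pos hc y)]; exact sechKernel_le hc y
  have huB : ∀ y, |fermiKernel (U / 4) y| ≤ 1 / (2 * π * (U / 4)) := fun y => by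
    rw [abs_of_nonneg (fermiKernel_nonneg hc y)]; exact fermiKernel_le hc y
  set A : ℝ → ℝ := (Ioc (-Real.sin Q) (Real.sin Q)).indicator (fun _ => (1 : ℝ)) with hA
  have hA1 : ∀ y, |A y| ≤ 1 := fun y => by
    by_cases hy : y ∈ Ioc (-Real.sin Q) (Real.sin Q)
    · simp [hA, indicator_of_mem hy]
    · simp [hA, indicator_of_notMem hy]
  have hAm : AEStronglyMeasurable A volume := aestronglyMeasurable_const.indicator measurableSet_Ioc
  -- inner convolutions
  have hG : ∀ (g : ℝ → ℝ), Integrable g → Integrable (fun y => A y * (∫ t, S.indicator g t *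
      cauchyDensity (U / 4) (y - t)) * sechKernel (U / 4) (x - y)) := by
    intro g hg
    obtain ⟨hGi, _⟩ := integrable_conv_and_integral (hg.indicator hS) (integrable_cauchyDensity hc.le)
    exact (hGi.bdd_mul hAm (Eventually.of_forall fun y => by rw [Real.norm_eq_abs]; exact hA1 y)).mul_bdd
      ((continuous_sechKernel hc).comp (continuous_const.sub continuous_id)).aestronglyMeasurable
      (Eventually.of_forall fun y => by rw [Real.norm_eq_abs]; exact hrB _)
  have hlin : liebWuWS U Q S h₂ x = liebWuWS U Q S h₁ x + liebWuWS U Q S (fun t => h₂ t - h₁ t) x := by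
    simp only [liebWuWS, liebWuW]
    have e1 : ∀ y, (∫ t, S.indicator h₂ t * cauchyDensity (U / 4) (y - t)) =
        (∫ t, S.indicator h₁ t * cauchyDensity (U / 4) (y - t)) +
          ∫ t, S.indicator (fun t => h₂ t - h₁ t) t * cauchyDensity (U / 4) (y - t) := by
      intro y
      rw [← integral_add (integrable_mul_sub (h₁i.indicator hS) (continuous_cauchyDensity hc) hKB y)
        (integrable_mul_sub (hd.indicator hS) (continuous_cauchyDensity hc) hKB y)]
      refine integral_congr_ae (Eventually.of_forall fun t => ?_)
      by_cases ht : t ∈ S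
      · simp only [indicator_of_mem ht]; ring
      · simp only [indicator_of_notMem ht]; ring
    have e2 : (∫ t, Sᶜ.indicator h₂ t * fermiKernel (U / 4) (x - t)) =
        (∫ t, Sᶜ.indicator h₁ t * fermiKernel (U / 4) (x - t)) +
          ∫ t, Sᶜ.indicator (fun t => h₂ t - h₁ t) t * fermiKernel (U / 4) (x - t) := by
      rw [← integral_add (integrable_mul_sub (h₁i.indicator hS.compl) (continuous_fermiKernel hc) huB x)
        (integrable_mul_sub (hd.indicator hS.compl) (continuous_fermiKernel hc) huB x)]
      refine integral_congr_ae (Eventually.of_forall fun t => ?_)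
      by_cases ht : t ∈ Sᶜ
      · simp only [indicator_of_mem ht]; ring
      · simp only [indicator_of_notMem ht]; ring
    simp_rw [e1]
    have e3 : (∫ y, A y * ((∫ t, S.indicator h₁ t * cauchyDensity (U / 4) (y - t)) +
        ∫ t, S.indicator (fun t => h₂ t - h₁ t) t * cauchyDensity (U / 4) (y - t)) * sechKernel (U / 4) (x - y)) =
        (∫ y, A y * (∫ t, S.indicator h₁ t * cauchyDensity (U / 4) (y - t)) * sechKernel (U / 4) (x - y)) +
          ∫ y, A y * (∫ t, S.indicator (fun t => h₂ t - h₁ t) t * cauchyDensity (U / 4) (y - t)) *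
            sechKernel (U / 4) (x - y) := by
      rw [← integral_add (hG h₁ h₁i) (hG _ hd)]
      refine integral_congr_ae (Eventually.of_forall fun y => ?_)
      ring
    rw [e3, e2]
    ring
  rw [hlin]
  linarith [hWd0 x]

/-! ### The terms and the series -/

/-- **Term-wise bounds**: each `Ŵⁿξ` is continuous, nonnegative, integrable, with `∫ Ŵⁿξ ≤ 2⁻ⁿ ∫ξ`.
[cite: LiebWuPhysicaA2003, §5, eq. (series)] -/
theorem liebWuNeumannTermS_props (hU : 0 < U) (hQ : 0 < Q) (hS : MeasurableSet S) (n : ℕ) :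
    Continuous (liebWuNeumannTermS U Q S n) ∧ (∀ x, 0 ≤ liebWuNeumannTermS U Q S n x) ∧
      Integrable (liebWuNeumannTermS U Q S n) ∧
      (∫ x, liebWuNeumannTermS U Q S n x) ≤ (1 / 2) ^ n * ∫ x, liebWuXi U Q x := by
  induction n with
  | zero =>
    refine ⟨continuous_liebWuXi hU Q, fun x => (liebWuXi_pos hU hQ x).le,
      (integrable_liebWuXi_and_integral hU hQ).1, ?_⟩
    simp [liebWuNeumannTermS]
  | succ n ih =>
    obtain ⟨_, h0, hi, hint⟩ := ih
    obtain ⟨hc', h0', hi', hint', _⟩ := liebWuWS_props (Q := Q) hU hS hi h0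
    refine ⟨hc', h0', hi', ?_⟩
    calc (∫ x, liebWuNeumannTermS U Q S (n + 1) x) = ∫ x, liebWuWS U Q S (liebWuNeumannTermS U Q S n) x := rfl
      _ ≤ 1 / 2 * ∫ x, liebWuNeumannTermS U Q S n x := hint'
      _ ≤ 1 / 2 * ((1 / 2) ^ n * ∫ x, liebWuXi U Q x) := mul_le_mul_of_nonneg_left hint (by norm_num)
      _ = (1 / 2) ^ (n + 1) * ∫ x, liebWuXi U Q x := by ring

/-- **Uniform bound**: `Ŵⁿ⁺¹ξ(x) ≤ (1/U) 2⁻ⁿ ∫ξ`. [cite: LiebWuPhysicaA2003, §5, eq. (series)] -/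
theorem liebWuNeumannTermS_succ_le (hU : 0 < U) (hQ : 0 < Q) (hS : MeasurableSet S) (n : ℕ) (x : ℝ) :
    liebWuNeumannTermS U Q S (n + 1) x ≤ 1 / (4 * (U / 4)) * ((1 / 2) ^ n * ∫ y, liebWuXi U Q y) := by
  obtain ⟨_, h0, hi, hint⟩ := liebWuNeumannTermS_props hU hQ hS n
  obtain ⟨_, _, _, _, hsup⟩ := liebWuWS_props (Q := Q) hU hS hi h0
  exact (hsup x).trans (mul_le_mul_of_nonneg_left hint (by positivity))

/-- The summable majorant of the Neumann terms: `‖Ŵⁿξ‖ ≤ 2(M₀ + M₁) 2⁻ⁿ` with `M₀ = Q/(4πc)` and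
`M₁ = (1/(4c)) ∫ξ`. [cite: LiebWuPhysicaA2003, §5, eq. (series)] -/
theorem liebWuNeumannTermS_le_majorant (hU : 0 < U) (hQ : 0 < Q) (hS : MeasurableSet S) (n : ℕ) (x : ℝ) :
    ‖liebWuNeumannTermS U Q S n x‖ ≤
      2 * (1 / (4 * π) * ((1 / (2 * (U / 4))) * (Q - -Q)) + 1 / (4 * (U / 4)) * ∫ y, liebWuXi U Q y) *
        (1 / 2) ^ n := by
  have hI : 0 ≤ ∫ y, liebWuXi U Q y := integral_nonneg fun y => (liebWuXi_pos hU hQ y).le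
  have hM0 : 0 ≤ 1 / (4 * π) * ((1 / (2 * (U / 4))) * (Q - -Q)) := by
    have : 0 ≤ Q - -Q := by linarith
    positivity
  have hM1 : 0 ≤ 1 / (4 * (U / 4)) * ∫ y, liebWuXi U Q y := by positivity
  rw [Real.norm_eq_abs, abs_of_nonneg ((liebWuNeumannTermS_props hU hQ hS n).2.1 x)]
  cases n with
  | zero =>
    simp only [liebWuNeumannTermS, pow_zero, mul_one]
    linarith [liebWuXi_le hU hQ x]
  | succ n =>
    have hp : (0 : ℝ) ≤ (1 / 2) ^ n := by positivity
    calc liebWuNeumannTermS U Q S (n + 1) x ≤ 1 / (4 * (U / 4)) * ((1 / 2) ^ n * ∫ y, liebWuXi U Q y) :=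
          liebWuNeumannTermS_succ_le hU hQ hS n x
      _ = 2 * (1 / (4 * (U / 4)) * ∫ y, liebWuXi U Q y) * (1 / 2) ^ (n + 1) := by ring
      _ ≤ _ := by
          rw [pow_succ]
          nlinarith [hM0, hM1, hp]

/-- **The Neumann series converges** (pointwise absolutely, uniformly). [cite: LiebWuPhysicaA2003, §5, eq. (series)] -/
theorem summable_liebWuNeumannTermS (hU : 0 < U) (hQ : 0 < Q) (hS : MeasurableSet S) (x : ℝ) :
    Summable fun n => liebWuNeumannTermS U Q S n x :=
  Summable.of_norm_bounded ((summable_geometric_of_lt_one (by norm_num) (by norm_num)).mul_left _)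
    (fun n => liebWuNeumannTermS_le_majorant hU hQ hS n x)

/-- **`σ_S` is continuous** (uniform convergence). [cite: LiebWuPhysicaA2003, §5, eq. (series)] -/
theorem continuous_liebWuSigmaAtS (hU : 0 < U) (hQ : 0 < Q) (hS : MeasurableSet S) :
    Continuous (liebWuSigmaAtS U Q S) :=
  continuous_tsum (fun n => (liebWuNeumannTermS_props hU hQ hS n).1)
    ((summable_geometric_of_lt_one (by norm_num) (by norm_num)).mul_left _)
    (fun n x => liebWuNeumannTermS_le_majorant hU hQ hS n x)

/-- **`σ_S > 0` everywhere** ("since each term is a positive function"; indeed `σ_S ≥ ξ > 0`).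
[cite: LiebWuPhysicaA2003, §5, Theorem 1] -/
theorem liebWuSigmaAtS_pos (hU : 0 < U) (hQ : 0 < Q) (hS : MeasurableSet S) (x : ℝ) :
    0 < liebWuSigmaAtS U Q S x := by
  rw [liebWuSigmaAtS, (summable_liebWuNeumannTermS hU hQ hS x).tsum_eq_zero_add]
  exact add_pos_of_pos_of_nonneg (liebWuXi_pos hU hQ x)
    (tsum_nonneg fun n => (liebWuNeumannTermS_props hU hQ hS (n + 1)).2.1 x)

/-- `ξ ≤ σ_S`. [cite: LiebWuPhysicaA2003, §5, eq. (series)] -/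
theorem liebWuXi_le_liebWuSigmaAtS (hU : 0 < U) (hQ : 0 < Q) (hS : MeasurableSet S) (x : ℝ) :
    liebWuXi U Q x ≤ liebWuSigmaAtS U Q S x := by
  rw [liebWuSigmaAtS, (summable_liebWuNeumannTermS hU hQ hS x).tsum_eq_zero_add]
  exact le_add_of_nonneg_right (tsum_nonneg fun n => (liebWuNeumannTermS_props hU hQ hS (n + 1)).2.1 x)

/-- The integrals of the terms are summable (`≤ Σ 2⁻ⁿ ∫ξ`). [cite: LiebWuPhysicaA2003, §5, eq. (series)] -/
theorem summable_integral_liebWuNeumannTermS (hU : 0 < U) (hQ : 0 < Q) (hS : MeasurableSet S) :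
    Summable fun n => ∫ x, ‖liebWuNeumannTermS U Q S n x‖ := by
  refine Summable.of_nonneg_of_le (fun n => integral_nonneg fun x => norm_nonneg _) (fun n => ?_)
    ((summable_geometric_of_lt_one (by norm_num : (0 : ℝ) ≤ 1 / 2) (by norm_num)).mul_right
      (∫ x, liebWuXi U Q x))
  have h := liebWuNeumannTermS_props hU hQ hS n
  calc ∫ x, ‖liebWuNeumannTermS U Q S n x‖ = ∫ x, liebWuNeumannTermS U Q S n x :=
        integral_congr_ae (Eventually.of_forall fun x => Real.norm_of_nonneg (h.2.1 x))
    _ ≤ (1 / 2) ^ n * ∫ x, liebWuXi U Q x := h.2.2.2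

/-- **`σ_S ∈ L¹`**. [cite: LiebWuPhysicaA2003, §5, eq. (series)] -/
theorem integrable_liebWuSigmaAtS (hU : 0 < U) (hQ : 0 < Q) (hS : MeasurableSet S) :
    Integrable (liebWuSigmaAtS U Q S) := by
  have hprops := liebWuNeumannTermS_props hU hQ hS
  have hsum := summable_integral_liebWuNeumannTermS hU hQ hS
  have hσ0 : ∀ x, 0 ≤ liebWuSigmaAtS U Q S x := fun x => (liebWuSigmaAtS_pos hU hQ hS x).le
  refine (lintegral_ofReal_ne_top_iff_integrable (continuous_liebWuSigmaAtS hU hQ hS).aestronglyMeasurable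
    (Eventually.of_forall hσ0)).1 ?_
  have h1 : ∀ x, ENNReal.ofReal (liebWuSigmaAtS U Q S x) =
      ∑' n, ENNReal.ofReal (liebWuNeumannTermS U Q S n x) := fun x =>
    ENNReal.ofReal_tsum_of_nonneg (fun n => (hprops n).2.1 x) (summable_liebWuNeumannTermS hU hQ hS x)
  simp_rw [h1]
  rw [lintegral_tsum fun n => (hprops n).1.measurable.ennreal_ofReal.aemeasurable]
  have h2 : ∀ n, ∫⁻ x, ENNReal.ofReal (liebWuNeumannTermS U Q S n x) =
      ENNReal.ofReal (∫ x, ‖liebWuNeumannTermS U Q S n x‖) := fun n => by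
    rw [← ofReal_integral_eq_lintegral_ofReal (hprops n).2.2.1 (Eventually.of_forall (hprops n).2.1)]
    congr 1
    exact integral_congr_ae (Eventually.of_forall fun x => (Real.norm_of_nonneg ((hprops n).2.1 x)).symm)
  simp_rw [h2]
  rw [← ENNReal.ofReal_tsum_of_nonneg (fun n => integral_nonneg fun x => norm_nonneg _) hsum]
  exact ENNReal.ofReal_ne_top

/-- The series of the integrals: `∫ σ_S = Σ ∫ Ŵⁿξ ≤ 2 ∫ ξ`. [cite: LiebWuPhysicaA2003, §5, eq. (series)] -/
theorem integral_liebWuSigmaAtS_le (hU : 0 < U) (hQ : 0 < Q) (hS : MeasurableSet S) :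
    ∫ x, liebWuSigmaAtS U Q S x ≤ 2 * ∫ x, liebWuXi U Q x := by
  have hprops := liebWuNeumannTermS_props hU hQ hS
  have hsum := summable_integral_liebWuNeumannTermS hU hQ hS
  have hI : 0 ≤ ∫ y, liebWuXi U Q y := integral_nonneg fun y => (liebWuXi_pos hU hQ y).le
  have h := integral_tsum_of_summable_integral_norm (fun n => (hprops n).2.2.1) hsum
  have hfun : (fun x => ∑' n, liebWuNeumannTermS U Q S n x) = liebWuSigmaAtS U Q S := rfl
  rw [hfun] at h
  rw [← h]
  have hgeom : HasSum (fun n : ℕ => (1 / 2 : ℝ) ^ n * ∫ x, liebWuXi U Q x) (2 * ∫ x, liebWuXi U Q x) :=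
    hasSum_geometric_two.mul_right (∫ x, liebWuXi U Q x)
  refine (Summable.tsum_le_tsum (fun n => (hprops n).2.2.2) ?_ hgeom.summable).trans_eq hgeom.tsum_eq
  refine hsum.congr fun n => ?_
  exact integral_congr_ae (Eventually.of_forall fun x => Real.norm_of_nonneg ((hprops n).2.1 x))

end Literature.MathematicalPhysics.QuantumLattice

end
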